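import Summits.BirchSwinnertonDyer.BirchSwinnertonDyer.Theorems.TeichmullerTwistDescentKOfRationalMultOne
import Literature.NumberTheory.ModularSymbols.CuspidalHomologyRationalDual
import HarnessLib

/-!
# Route `TeichmullerTwistDescent`, crux K `TwistedPeriodLatticeSaturation` (stmt-BirchSwinnertonDyer-25368):
# K, LITERALLY, from modularity + DUAL SEPARATION on `S₂(Γ₀(N))^∨` + the tame-type carrier functional

Cell `pub/bsd-wall` (D-0145 line route-BirchSwinnertonDyer-TeichmullerTwistDescent, OPEN rev 7), seat `bsd-line-ttd-p1`
(prover 1/2, g24).  THEOREMS ONLY (no definition, no named fact, no `sorry`).  BSD is not proved by this file; K is NOT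
proved by this file: the main theorem is CONDITIONAL, with the route decl `TwistedPeriodLatticeSaturation` verbatim as its
conclusion.  Compared with `TeichmullerTwistDescentKOfRationalMultOne`, the multiplicity-one hypothesis is moved from the
rational homology `H(N; ℚ)` to the complex vector space `S₂(Γ₀(N))^∨` (`Literature.…CuspidalHomologyRationalDual`: the embedding
`ℚ ⊗ H₁(X₀(N), ℤ) ↪ S₂(Γ₀(N))^∨` is injective, Hecke-equivariant, and evaluation at `f` is the period class map):

* `hDS` — DUAL SEPARATION: for a curve of conductor `N`, its datum `D` (newform `f = D.f`) and a prime `p ≥ 11` with `p² ∣ N`,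
  there are finitely many primes `q_i ≠ p` and integers `a_i` with `T_{q_i} f = a_i f` such that every functional
  `ψ ∈ S₂(Γ₀(N))^∨` killed by powers of the transposes `(T_{q_i}^∨ − a_i)` and vanishing at `f` is zero.  (Atkin–Lehner:
  `S₂(Γ₀(N))` is spanned by the `g(dz)`, `g` a newform of level `M ∣ N`, on which `T_q` (`q ∤ N`) acts by `a_q(g)`; strong
  multiplicity one separates `f` from every other `g` at some `q ∤ N`; the line of `f` is `ℂ f`.)

REMAINING INPUTS of the K-line after this file: `hDS` (Atkin–Lehner theory + strong multiplicity one — both PROVED in the tree: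
`iSup_atkinLehnerComponent_eq_top`, `span_newforms0_holds`, `IsNewform0.eq_of_heckeEigenvalue_eq_holds`; the assembly is the
successor's task), `hcar` (the integral tame-type carrier functional — the load-bearing open input), `hnf` (modularity).
-/

set_option linter.dupNamespace false

noncomputable section

open scoped Pointwise MatrixGroups TensorProduct

open Function CongruenceSubgroup
open Literature.RepresentationTheory.FiniteGroups Literature.RepresentationTheory.FiniteGroups.GL2
  Literature.NumberTheory.EllipticCurves.ModularForms
open Literature.NumberTheory.EllipticCurves (Kato2004.teichmullerChar)
open Literature.NumberTheory.ModularSymbols Literature.NumberTheory.ModularSymbols.FullLevel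
open Literature.Algebra.Homology

namespace Summit.BirchSwinnertonDyer.BirchSwinnertonDyer.Theorems.TeichmullerTwistDescent.KOfDualSeparation

open WeierstrassCurve Literature.NumberTheory.EllipticCurves
  Summit.BirchSwinnertonDyer.BirchSwinnertonDyer.Theorems.TeichmullerTwistDescent.KOfRationalMultOne

/-- **K from modularity, dual separation for `f_E` on `S₂(Γ₀(N))^∨`, and the integral tame-type carrier functional.**
The conclusion is the route decl `TwistedPeriodLatticeSaturation` VERBATIM; BSD is not proved by this, K only CONDITIONALLY on the
three hypotheses described in the module docstring.  Proof: `hDS` ⇒ rational multiplicity one on `H(N; ℚ)`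
(`Literature.…CuspidalHomologyRationalDual.eq_zero_of_dualSeparation_T`) ⇒ `KOfRationalMultOne`.
[cite: DarmonDiamondTaylor1995, §1.3 (p. 32)] [cite: Shimura1971, Thm. 3.51] [cite: EdixhovenManin1991, §4] -/
theorem twistedPeriodLatticeSaturation_of_dualSeparation (hnf : exists_isNewformOf)
    (hDS : ∀ (N p : ℕ) [NeZero N] [Fact p.Prime] (W : WeierstrassCurve ℚ) [W.IsElliptic] [W.IsGloballyMinimal],
      W.conductorNorm ℤ = N → ∀ D : ModularParametrizationData W N, p ^ 2 ∣ N → 11 ≤ p →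
      ∃ (s : Finset {q : ℕ // q.Prime ∧ q ≠ p}) (a : {q : ℕ // q.Prime ∧ q ≠ p} → ℤ),
        (∀ i ∈ s, HeckeRing0.toEnd N 2 (HeckeRing0.T N 2 i.1 i.2.1) D.f = (a i : ℂ) • D.f) ∧
        ∀ ψ : Module.Dual ℂ (CuspForm (Gamma0 N) 2),
          (∀ i ∈ s, ∃ k : ℕ, (((HeckeRing0.toEnd N 2 (HeckeRing0.T N 2 i.1 i.2.1)).dualMap - (a i : ℂ) • 1) ^ k) ψ = 0) →
            ψ D.f = 0 → ψ = 0)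
    (hcar : ∀ (p M : ℕ) [Fact p.Prime] [NeZero M] [NeZero (p ^ 2 * M)] (hpM : Nat.Coprime p M)
      [Fintype (diagTorus (ZMod p))] [Invertible (Fintype.card (diagTorus (ZMod p)) : ℤ_[p])]
      (W : WeierstrassCurve ℚ) [W.IsElliptic] [W.IsGloballyMinimal], W.conductorNorm ℤ = p ^ 2 * M →
      ∀ D : ModularParametrizationData W (p ^ 2 * M), 11 ≤ p → Rank1Residual.Addv W p → Rank1Residual.Irr W p →
      Summit.BirchSwinnertonDyer.Rank1Residual.Additive.TypeGOrd W p → padicValInt p W.minimalDiscriminantInt ≤ 4 →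
      ∃ (b m : ℕ) (Ψ : spreadLattice ℤ_[p] p M hpM D.f →ₗ[ℤ_[p]] (Option (ZMod p) → ℤ_[p])),
        0 < b ∧ 2 * b < p - 1 ∧
        IsEquivariantOnSpread ℤ_[p] p M hpM D.f
          (coordRep (Kato2004.teichmullerChar p ^ (p - 1 - b)) (Kato2004.teichmullerChar p ^ b)) Ψ ∧
        (∀ v : Option (ZMod p) → ℤ_[p], (p : ℤ_[p]) ^ m • v ∈ LinearMap.range Ψ) ∧
        ∀ Λ' : Subrepresentation (coordRep (Kato2004.teichmullerChar p ^ (p - 1 - b)) (Kato2004.teichmullerChar p ^ b)),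
          Λ'.toSubmodule = LinearMap.range Ψ →
            @ReductionSocleLe p _ (ZMod p) _ _ (PadicInt.toZMod (p := p)).toAlgebra
              (Kato2004.teichmullerChar p ^ (p - 1 - b)) (Kato2004.teichmullerChar p ^ b) (2 * b) Λ') :
    Summit.BirchSwinnertonDyer.BirchSwinnertonDyer.Theses.TeichmullerTwistDescent.TwistedPeriodLatticeSaturation := by
  refine twistedPeriodLatticeSaturation_of_rationalMultOne hnf (fun N p _ _ W _ _ hN D hsq hp11 => ?_) hcar
  obtain ⟨s, a, hT, hsep⟩ := hDS N p W hN D hsq hp11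
  exact ⟨s, a, hT, fun v hv hφ =>
    eq_zero_of_dualSeparation_T N D.f s (fun i => i.1) (fun i => i.2.1) a hsep v hv hφ⟩

end Summit.BirchSwinnertonDyer.BirchSwinnertonDyer.Theorems.TeichmullerTwistDescent.KOfDualSeparation
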